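import Literature.Probability.LatticeModels.CableGFFLevelSets
import Literature.Probability.LatticeModels.DiscreteGFFSetFlip
import HarnessLib

/-!
# Lupu's symmetric coupling weights `1 - e^{-2(φ_x φ_y)⁺}` and their behaviour under sign flips

Topic `Literature/Probability/LatticeModels`. Brick 5 of the proof of
`Literature.Probability.LatticeModels.Lupu2016_cableSignClustersBounded` (Lupu 2016, Prop. 5.5).
Lupu's Thm. 1 bis / Lemma 4.1 (E2) describe, conditionally on the field `ψ`, the set of edges
not used by any cluster: edge `{x,y}` is open independently with probability
`1_{ψ_x ψ_y > 0} (1 - e^{-2 C(x,y) |ψ_x ψ_y|})` (end of the proof of Lemma 4.1: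
"`1 - e^{-C(x,y)(|ψ_xψ_y|+ψ_xψ_y)} = 1_{ψ_xψ_y>0}(1 - e^{-2C(x,y)|ψ_xψ_y|})`", here `C = 1`). This is `symWeight ψ {x,y} = 1 - exp(-2 (ψ_x ψ_y)⁺)` (`0` on non-edges); the
`lupuWeight` of `CableGFFLevelSets.lean` is its restriction to the positive side, and
`lupuWeight ≤ symWeight` (`lupuWeight_le_symWeight`), so the positive clusters of the fact are
contained in the clusters of the symmetric model.

Contents (all proved): the closed form on edges, `lupuWeight ≤ symWeight`, continuity in `φ`,
the vanishing `symWeight φ {x,y} = 0` when `φ_x φ_y ≤ 0` (clusters are sign-monochromatic),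
invariance of `symWeight` under flipping both or no endpoint (`symWeight_setFlip_of_iff`), and the
boundary bookkeeping for a finite `S ⊆ Λ`: with `pairBd Λ S` the oriented lattice edges
`(a, v)`, `a ∈ S`, `v ∈ Λ ∖ S`, and `bdEdges Λ S` their unoriented images,
`flipExponent S ψ = ∑_{(a,v) ∈ pairBd Λ S} ψ_a ψ_v` for `ψ` vanishing off `Λ`
(`flipExponent_eq_sum_pairBd`) and the **key cancellation**
`(∏_{e ∈ bdEdges} (1 - symWeight (R_S ψ) e)) · exp(-2 flipExponent S ψ) = ∏_{e ∈ bdEdges} (1 - symWeight ψ e)`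
(`prod_one_sub_symWeight_setFlip_mul_exp`): flipping a cluster leaves the probability of its
closed boundary times the Gaussian cross-term factor invariant ("`(-t)⁺ + t = t⁺`"), which is
why, given the clusters, their signs are fair coins (Lupu 2016, proof of Prop. 4.2).

References: T. Lupu, Ann. Probab. 44 (2016), Thm. 1 bis, Lemma 4.1, Prop. 4.2 [`Lupu2016`].
-/

noncomputable section

namespace Literature.Probability.LatticeModels

open Finset

variable {d : ℕ}

/-! ### The symmetric weights -/

/-- **Lupu's symmetric coupling weight** of the bond `e = {x,y}` in the field `φ`:
`1 - exp(-2 (φ_x φ_y)⁺) ∈ [0,1]` on edges of `zdGraph d`, `0` on non-edges — conditionally on the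
field, the probability that `{x,y}` joins `x` and `y` in the same cluster
(`1_{φ_xφ_y>0}(1 - e^{-2|φ_xφ_y|})`, Lupu 2016, Thm. 1 bis and Lemma 4.1 (E2), `C = 1`).
[cite: Lupu2016, Thm. 1 bis and Lemma 4.1] -/
def symWeight (φ : Site d → ℝ) : Sym2 (Site d) → unitInterval :=
  fun e => if e ∈ (zdGraph d).edgeSet then
    Set.projIcc (0 : ℝ) 1 zero_le_one (1 - Real.exp (-2 * max (e.map φ).mul 0)) else 0

/-- `1 - exp(-2 t)` lies in `[0,1]` for `t ≥ 0`. [folklore] -/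
theorem one_sub_exp_neg_two_mul_mem_Icc {t : ℝ} (ht : 0 ≤ t) :
    1 - Real.exp (-2 * t) ∈ Set.Icc (0 : ℝ) 1 := by
  constructor
  · have : Real.exp (-2 * t) ≤ 1 := Real.exp_le_one_iff.2 (by nlinarith)
    linarith
  · linarith [Real.exp_pos (-2 * t)]

/-- Non-edges carry symmetric weight `0`. [folklore] -/
theorem symWeight_of_not_mem (φ : Site d → ℝ) {e : Sym2 (Site d)}
    (he : e ∉ (zdGraph d).edgeSet) : symWeight φ e = 0 := by
  simp only [symWeight, he, if_false]

/-- On an edge `{x,y}` of `ℤ^d`, `symWeight φ {x,y} = 1 - exp(-2 (φ_x φ_y)⁺)`.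
[cite: Lupu2016, Lemma 4.1] -/
theorem coe_symWeight_of_adj (φ : Site d → ℝ) {x y : Site d} (h : (zdGraph d).Adj x y) :
    (symWeight φ s(x, y) : ℝ) = 1 - Real.exp (-2 * max (φ x * φ y) 0) := by
  have he : s(x, y) ∈ (zdGraph d).edgeSet := (SimpleGraph.mem_edgeSet _).2 h
  simp only [symWeight, he, if_true, Sym2.map_mk, Sym2.mul_mk]
  rw [Set.projIcc_of_mem _ (one_sub_exp_neg_two_mul_mem_Icc (le_max_right _ _))]

/-- `1 - symWeight φ {x,y} = exp(-2 (φ_x φ_y)⁺)` on an edge. [cite: Lupu2016, Lemma 4.1] -/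
theorem one_sub_coe_symWeight_of_adj (φ : Site d → ℝ) {x y : Site d} (h : (zdGraph d).Adj x y) :
    1 - (symWeight φ s(x, y) : ℝ) = Real.exp (-2 * max (φ x * φ y) 0) := by
  rw [coe_symWeight_of_adj φ h]; ring

/-- **The positive-side weights are dominated by the symmetric ones**: `lupuWeight φ ≤ symWeight φ`
(`φ_x⁺ φ_y⁺ ≤ (φ_x φ_y)⁺`), so every configuration open for the positive model is open for the
symmetric model in the standard coupling. [cite: Lupu2016, Thm. 1 bis] -/
theorem lupuWeight_le_symWeight (φ : Site d → ℝ) : lupuWeight φ ≤ symWeight φ := by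
  intro e
  induction e using Sym2.ind with
  | _ x y =>
    by_cases he : s(x, y) ∈ (zdGraph d).edgeSet
    · have hadj := (SimpleGraph.mem_edgeSet _).1 he
      change (lupuWeight φ s(x, y) : ℝ) ≤ symWeight φ s(x, y)
      rw [coe_lupuWeight_of_adj φ hadj, coe_symWeight_of_adj φ hadj]
      have hle : max (φ x) 0 * max (φ y) 0 ≤ max (φ x * φ y) 0 := by
        rcases le_or_gt 0 (φ x) with hx | hx
        · rcases le_or_gt 0 (φ y) with hy | hy
          · rw [max_eq_left hx, max_eq_left hy]; exact le_max_left _ _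
          · rw [max_eq_right hy.le, mul_zero]; exact le_max_right _ _
        · rw [max_eq_right hx.le, zero_mul]; exact le_max_right _ _
      have := Real.exp_le_exp.2 (show -2 * max (φ x * φ y) 0 ≤ -2 * (max (φ x) 0 * max (φ y) 0)
        by linarith)
      linarith
    · rw [lupuWeight_of_not_mem φ he, symWeight_of_not_mem φ he]

/-- The symmetric weight of a fixed bond depends continuously on the field. [folklore] -/
theorem continuous_coe_symWeight (e : Sym2 (Site d)) :
    Continuous fun φ : Site d → ℝ => (symWeight φ e : ℝ) := by
  induction e using Sym2.ind with
  | _ x y =>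
    by_cases he : s(x, y) ∈ (zdGraph d).edgeSet
    · have hadj := (SimpleGraph.mem_edgeSet _).1 he
      simp_rw [coe_symWeight_of_adj _ hadj]
      fun_prop
    · simp_rw [symWeight_of_not_mem _ he]
      exact continuous_const

/-- **Clusters are monochromatic**: a bond between endpoints of weakly opposite signs has weight
`0`. [cite: Lupu2016, Thm. 1 bis] -/
theorem symWeight_eq_zero_of_mul_nonpos (φ : Site d → ℝ) {x y : Site d} (h : φ x * φ y ≤ 0) :
    symWeight φ s(x, y) = 0 := by
  by_cases he : s(x, y) ∈ (zdGraph d).edgeSet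
  · apply Subtype.ext
    rw [coe_symWeight_of_adj φ ((SimpleGraph.mem_edgeSet _).1 he), max_eq_right h]
    simp
  · exact symWeight_of_not_mem φ he

/-! ### Behaviour under the set flip `R_S` -/

/-- Flipping both endpoints or neither leaves the weight unchanged. [folklore] -/
theorem symWeight_setFlip_of_iff (S : Finset (Site d)) (φ : Site d → ℝ) {x y : Site d}
    (h : x ∈ S ↔ y ∈ S) : symWeight (setFlip S φ) s(x, y) = symWeight φ s(x, y) := by
  by_cases he : s(x, y) ∈ (zdGraph d).edgeSet
  · have hadj := (SimpleGraph.mem_edgeSet _).1 he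
    apply Subtype.ext
    rw [coe_symWeight_of_adj _ hadj, coe_symWeight_of_adj _ hadj]
    by_cases hx : x ∈ S
    · simp [setFlip, hx, h.1 hx]
    · have hy : y ∉ S := fun hy => hx (h.2 hy)
      simp [setFlip, hx, hy]
  · rw [symWeight_of_not_mem _ he, symWeight_of_not_mem _ he]

/-- Across the boundary of `S` the flip changes the sign of the product:
`1 - symWeight (R_S φ) {x,y} = exp(-2 (-φ_x φ_y)⁺)` for `x ∈ S`, `y ∉ S`. [folklore] -/
theorem one_sub_coe_symWeight_setFlip_of_mem_not_mem (S : Finset (Site d)) (φ : Site d → ℝ)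
    {x y : Site d} (h : (zdGraph d).Adj x y) (hx : x ∈ S) (hy : y ∉ S) :
    1 - (symWeight (setFlip S φ) s(x, y) : ℝ) = Real.exp (-2 * max (-(φ x * φ y)) 0) := by
  rw [one_sub_coe_symWeight_of_adj _ h]
  simp [setFlip, hx, hy]

/-- `(-t)⁺ + t = t⁺`. [folklore] -/
theorem max_neg_zero_add_self (t : ℝ) : max (-t) 0 + t = max t 0 := by
  rcases le_or_gt 0 t with ht | ht
  · rw [max_eq_right (by linarith), max_eq_left ht, zero_add]
  · rw [max_eq_left (by linarith), max_eq_right ht.le]; ring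

/-! ### Boundary pairs and boundary edges of `S ⊆ Λ` -/

/-- The oriented boundary pairs of `S` inside `Λ`: `(a, v)` with `a ∈ S`, `v ∈ Λ ∖ S`, `a ∼ v`.
[folklore] -/
def pairBd (Λ S : Finset (Site d)) : Finset (Site d × Site d) :=
  (S ×ˢ (Λ \ S)).filter fun p => (zdGraph d).Adj p.1 p.2

/-- The boundary edges of `S` inside `Λ`: the unoriented images of `pairBd Λ S`. [folklore] -/
def bdEdges (Λ S : Finset (Site d)) : Finset (Sym2 (Site d)) :=
  (pairBd Λ S).image fun p => s(p.1, p.2)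

/-- Membership in `pairBd`. [folklore] -/
@[simp] theorem mem_pairBd {Λ S : Finset (Site d)} {p : Site d × Site d} :
    p ∈ pairBd Λ S ↔ p.1 ∈ S ∧ p.2 ∈ Λ ∧ p.2 ∉ S ∧ (zdGraph d).Adj p.1 p.2 := by
  simp only [pairBd, Finset.mem_filter, Finset.mem_product, Finset.mem_sdiff]
  tauto

/-- Membership in `bdEdges`: an edge of `ℤ^d` with one endpoint in `S` and the other in `Λ ∖ S`.
[folklore] -/
theorem mem_bdEdges_iff {Λ S : Finset (Site d)} {x y : Site d} :
    s(x, y) ∈ bdEdges Λ S ↔ (zdGraph d).Adj x y ∧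
      ((x ∈ S ∧ y ∈ Λ ∧ y ∉ S) ∨ (y ∈ S ∧ x ∈ Λ ∧ x ∉ S)) := by
  simp only [bdEdges, Finset.mem_image, mem_pairBd, Prod.exists, Sym2.eq, Sym2.rel_iff',
    Prod.mk.injEq, Prod.swap_prod_mk]
  constructor
  · rintro ⟨a, b, ⟨ha, hb, hbS, hab⟩, ⟨rfl, rfl⟩ | ⟨rfl, rfl⟩⟩
    · exact ⟨hab, Or.inl ⟨ha, hb, hbS⟩⟩
    · exact ⟨hab.symm, Or.inr ⟨ha, hb, hbS⟩⟩
  · rintro ⟨hadj, ⟨hx, hy, hyS⟩ | ⟨hy, hx, hxS⟩⟩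
    · exact ⟨x, y, ⟨hx, hy, hyS, hadj⟩, Or.inl ⟨rfl, rfl⟩⟩
    · exact ⟨y, x, ⟨hy, hx, hxS, hadj.symm⟩, Or.inr ⟨rfl, rfl⟩⟩

/-- Orienting a boundary edge from `S` outward is injective on `pairBd`. [folklore] -/
theorem injOn_mk_pairBd (Λ S : Finset (Site d)) :
    Set.InjOn (fun p : Site d × Site d => s(p.1, p.2)) ↑(pairBd Λ S) := by
  rintro ⟨a, b⟩ hab ⟨a', b'⟩ hab' h
  simp only [Finset.mem_coe, mem_pairBd] at hab hab'
  rcases Sym2.eq_iff.1 h with ⟨h1, h2⟩ | ⟨h1, h2⟩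
  · exact Prod.ext h1 h2
  · dsimp only at h1
    exact absurd (h1 ▸ hab.1) hab'.2.2.1

/-- Products over boundary edges are products over oriented boundary pairs. [folklore] -/
theorem prod_bdEdges (Λ S : Finset (Site d)) (f : Sym2 (Site d) → ℝ) :
    ∏ e ∈ bdEdges Λ S, f e = ∏ p ∈ pairBd Λ S, f s(p.1, p.2) := by
  rw [bdEdges, Finset.prod_image (injOn_mk_pairBd Λ S)]

/-- Boundary edges are edges of `ℤ^d` inside `Λ` (if `S ⊆ Λ`). [folklore] -/
theorem bdEdges_subset_edgesIn {Λ S : Finset (Site d)} (hS : S ⊆ Λ) :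
    bdEdges Λ S ⊆ edgesIn (zdGraph d) Λ := by
  intro e he
  induction e using Sym2.ind with
  | _ x y =>
    rw [mem_bdEdges_iff] at he
    rw [mem_edgesIn_iff]
    refine ⟨(SimpleGraph.mem_edgeSet _).2 he.1, fun z hz => ?_⟩
    rcases Sym2.mem_iff.1 hz with rfl | rfl
    · rcases he.2 with h | h
      · exact hS h.1
      · exact h.2.1
    · rcases he.2 with h | h
      · exact h.2.1
      · exact hS h.1

/-- Boundary edges are disjoint from the edges inside `S`. [folklore] -/
theorem disjoint_edgesIn_bdEdges (Λ S : Finset (Site d)) :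
    Disjoint (edgesIn (zdGraph d) S) (bdEdges Λ S) := by
  rw [Finset.disjoint_left]
  intro e he hb
  induction e using Sym2.ind with
  | _ x y =>
    rw [mem_edgesIn_iff] at he
    rw [mem_bdEdges_iff] at hb
    rcases hb.2 with h | h
    · exact h.2.2 (he.2 y (Sym2.mem_mk_right x y))
    · exact h.2.2 (he.2 x (Sym2.mem_mk_left x y))

/-- **`flipExponent` as a sum over boundary pairs**: for `S ⊆ Λ` and `ψ` vanishing off `Λ`,
`∑_{x ∈ S, v ∼ x, v ∉ S} ψ_x ψ_v = ∑_{(a,v) ∈ pairBd Λ S} ψ_a ψ_v`. [folklore] -/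
theorem flipExponent_eq_sum_pairBd {Λ S : Finset (Site d)} {ψ : Site d → ℝ}
    (hψ : ∀ v ∉ Λ, ψ v = 0) :
    flipExponent S ψ = ∑ p ∈ pairBd Λ S, ψ p.1 * ψ p.2 := by
  classical
  rw [pairBd, Finset.sum_filter, Finset.sum_product, flipExponent]
  refine Finset.sum_congr rfl fun a ha => ?_
  -- both sides are the sum over the neighbours of `a` in `Λ ∖ S`
  have hL : ∑ v ∈ (zdGraph d).neighborFinset a, (if v ∈ S then 0 else ψ a * ψ v) =
      ∑ v ∈ ((zdGraph d).neighborFinset a).filter (fun v => v ∈ Λ \ S), ψ a * ψ v := by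
    rw [Finset.sum_filter]
    refine Finset.sum_congr rfl fun v _ => ?_
    by_cases hvS : v ∈ S
    · simp [hvS]
    · by_cases hvΛ : v ∈ Λ
      · simp [hvS, hvΛ]
      · simp [hvS, hvΛ, hψ v hvΛ]
  have hR : ∑ v ∈ Λ \ S, (if (zdGraph d).Adj a v then ψ a * ψ v else 0) =
      ∑ v ∈ (Λ \ S).filter (fun v => (zdGraph d).Adj a v), ψ a * ψ v := by
    rw [Finset.sum_filter]
  rw [hL, hR]
  refine Finset.sum_congr ?_ fun _ _ => rfl
  ext v
  simp only [Finset.mem_filter, SimpleGraph.mem_neighborFinset]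
  tauto

/-- **The key cancellation** (Lupu 2016, proof of Prop. 4.2: the boundary factor is a function of
`|ψ|` once combined with the Gaussian cross terms): for `S ⊆ Λ` and `ψ` vanishing off `Λ`,
`(∏_{e ∈ bdEdges Λ S} (1 - symWeight (R_S ψ) e)) · exp(-2 flipExponent S ψ)
  = ∏_{e ∈ bdEdges Λ S} (1 - symWeight ψ e)`. [cite: Lupu2016, proof of Prop. 4.2] -/
theorem prod_one_sub_symWeight_setFlip_mul_exp {Λ S : Finset (Site d)} {ψ : Site d → ℝ}
    (hψ : ∀ v ∉ Λ, ψ v = 0) :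
    (∏ e ∈ bdEdges Λ S, (1 - (symWeight (setFlip S ψ) e : ℝ))) *
        Real.exp (-2 * flipExponent S ψ) =
      ∏ e ∈ bdEdges Λ S, (1 - (symWeight ψ e : ℝ)) := by
  rw [prod_bdEdges, prod_bdEdges, flipExponent_eq_sum_pairBd hψ, Finset.mul_sum, Real.exp_sum,
    ← Finset.prod_mul_distrib]
  refine Finset.prod_congr rfl fun p hp => ?_
  rw [mem_pairBd] at hp
  rw [one_sub_coe_symWeight_setFlip_of_mem_not_mem S ψ hp.2.2.2 hp.1 hp.2.2.1,
    one_sub_coe_symWeight_of_adj ψ hp.2.2.2, ← Real.exp_add]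
  congr 1
  have := max_neg_zero_add_self (ψ p.1 * ψ p.2)
  linarith

end Literature.Probability.LatticeModels
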